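import Mathlib.Topology.Algebra.FilterBasis
import Mathlib.Topology.Algebra.OpenSubgroup
import Literature.RepresentationTheory.HeisenbergGroup.ImplementerCocycle
import Literature.NumberTheory.Automorphic.SmoothRepresentation
import HarnessLib

/-!
# The smooth-vector topology on `S̃p_ψ(W)` (MVW Chap. 2 II.1, II.8)

Mœglin–Vignéras–Waldspurger, *Correspondances de Howe sur un corps p-adique* (LNM 1291, 1987), Chap. 2:
II.1 (A)–(B) define the group `S̃p_ψ(W) ⊆ Sp(W) × GL(S)` of pairs `(g, M)` with `M ρ_ψ(h) M⁻¹ = ρ_ψ(g h)`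
(our `MpPsi ρ`, file `LocalWeilProjective`); II.8 observes that the resulting representation `(g, M) ↦ M`
of `S̃p_ψ(W)` on `S` is smooth once `S̃p_ψ(W)` is topologised through `Sp(W)` and the (smooth) model.

This file performs that topologisation for an ARBITRARY model `ρ` of the Heisenberg group of `(W, B)` over
any field `k`, and an arbitrary *congruence basis* `𝒦 = (K_m)_m` of `Sp(W)` (a decreasing chain of subgroups,
stable under conjugation up to shrinking — e.g. the principal congruence subgroups of `Sp(W)` over a
non-archimedean local field):

* §1 `CongruenceBasis G`, its `GroupFilterBasis`, the group topology `𝒦.topology` it generates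
  (`IsTopologicalGroup`, the `K_m` open, a subgroup containing some `K_m` is open).
* §2 On `MpPsi ρ` the subgroups `U_{m,A} = {(g, M) | g ∈ K_m, M f = f for all f ∈ A}` (`A ⊆ S` finite),
  `MpPsi.smoothNhd`, form a congruence-type group filter basis `MpPsi.filterBasis` — the conjugation axiom
  holds for free: `(g, M) U_{m', M⁻¹A} (g, M)⁻¹ ⊆ U_{m,A}` — whence the **smooth-vector topology**
  `MpPsi.topology 𝒦 ρ` on `S̃p_ψ(W)`, a group topology in which
  - the projection `p : S̃p_ψ(W) → Sp(W)` is continuous (`MpPsi.continuous_proj`),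
  - **the tautological (Weil) representation `MpPsi.toRep ρ` is smooth** (`MpPsi.isSmooth_toRep`): the
    stabiliser of `f` contains the open subgroup `U_{0,{f}}`,
  - a subgroup of `S̃p_ψ(W)` containing some `U_{m,A}` is open (`MpPsi.isOpen_of_smoothNhd_le`) — this is how a
    compact open subgroup fixing a vector (MVW II.10) is shown to be open,
  - the scalars `kˣ ⊆ S̃p_ψ(W)` are discrete (`U_{m,A}` meets them trivially as soon as `A ∋ f ≠ 0`).

This is the topology in which the restricted tensor product over the places of a number field is formed
(`Literature.NumberTheory.Automorphic.FiniteAdeleWeilAssembly`: hypotheses `IsOpen (Kc v)` and `(r v).IsSmooth`).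
All statements are kernel-checked [folklore] group topology; MVW is cited for the objects. Nothing is a record.
-/

set_option autoImplicit false

noncomputable section

namespace Literature.RepresentationTheory.HeisenbergGroup

open Filter Topology
open scoped Pointwise

universe u v u' v' w

/-! ## §1 Congruence bases -/

/-- a **congruence basis** of a group: a decreasing chain of subgroups `K_0 ≥ K_1 ≥ …`, each conjugate
`g K_{m'} g⁻¹` shrinking into any `K_m`. [folklore] -/
structure CongruenceBasis (G : Type w) [Group G] where
  /-- the chain of subgroups -/
  K : ℕ → Subgroup G
  /-- it decreases -/
  antitone' : Antitone K
  /-- conjugation compatibility -/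
  conj' : ∀ (g : G) (m : ℕ), ∃ m' : ℕ, ∀ x ∈ K m', g * x * g⁻¹ ∈ K m

namespace CongruenceBasis

variable {G : Type w} [Group G] (𝒦 : CongruenceBasis G)

/-- the chain decreases. [folklore] -/
theorem antitone : Antitone 𝒦.K := 𝒦.antitone'

/-- conjugation compatibility. [folklore] -/
theorem conj (g : G) (m : ℕ) : ∃ m' : ℕ, ∀ x ∈ 𝒦.K m', g * x * g⁻¹ ∈ 𝒦.K m := 𝒦.conj' g m

/-- the group filter basis `{K_m}`. [folklore] -/
@[implicit_reducible]
def toGroupFilterBasis : GroupFilterBasis G where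
  sets := Set.range fun m => (𝒦.K m : Set G)
  nonempty := ⟨_, 0, rfl⟩
  inter_sets := by
    rintro _ _ ⟨m, rfl⟩ ⟨m', rfl⟩
    exact ⟨_, ⟨max m m', rfl⟩,
      Set.subset_inter (𝒦.antitone (le_max_left m m')) (𝒦.antitone (le_max_right m m'))⟩
  one' := by
    rintro _ ⟨m, rfl⟩
    exact (𝒦.K m).one_mem
  mul' := by
    rintro _ ⟨m, rfl⟩
    refine ⟨_, ⟨m, rfl⟩, ?_⟩
    rintro _ ⟨a, ha, b, hb, rfl⟩
    exact (𝒦.K m).mul_mem ha hb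
  inv' := by
    rintro _ ⟨m, rfl⟩
    exact ⟨_, ⟨m, rfl⟩, fun x hx => (𝒦.K m).inv_mem hx⟩
  conj' := by
    rintro g _ ⟨m, rfl⟩
    obtain ⟨m', hm'⟩ := 𝒦.conj g m
    exact ⟨_, ⟨m', rfl⟩, fun x hx => hm' x hx⟩

/-- `K_m` belongs to the filter basis. [folklore] -/
theorem mem_toGroupFilterBasis (m : ℕ) : (𝒦.K m : Set G) ∈ 𝒦.toGroupFilterBasis := ⟨m, rfl⟩

/-- the **congruence topology** generated by `{K_m}`. [folklore] -/
@[implicit_reducible]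
def topology : TopologicalSpace G := 𝒦.toGroupFilterBasis.topology

/-- it is a group topology. [folklore] -/
theorem isTopologicalGroup : @IsTopologicalGroup G 𝒦.topology _ :=
  𝒦.toGroupFilterBasis.isTopologicalGroup

/-- `K_m` is a neighbourhood of `1`. [folklore] -/
theorem mem_nhds_one (m : ℕ) : (𝒦.K m : Set G) ∈ @nhds G 𝒦.topology 1 :=
  𝒦.toGroupFilterBasis.mem_nhds_one (𝒦.mem_toGroupFilterBasis m)

/-- the `K_m` form a basis of neighbourhoods of `1`. [folklore] -/
theorem nhds_one_hasBasis :
    (@nhds G 𝒦.topology 1).HasBasis (fun _ : ℕ => True) fun m => (𝒦.K m : Set G) := by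
  refine (𝒦.toGroupFilterBasis.nhds_one_hasBasis).to_hasBasis ?_ fun m _ => ⟨_, ⟨m, rfl⟩, le_rfl⟩
  rintro _ ⟨m, rfl⟩
  exact ⟨m, trivial, le_rfl⟩

/-- `K_m` is open. [folklore] -/
theorem isOpen_K (m : ℕ) : @IsOpen G 𝒦.topology (𝒦.K m) := by
  letI := 𝒦.topology
  haveI := 𝒦.isTopologicalGroup
  exact Subgroup.isOpen_of_mem_nhds _ (𝒦.mem_nhds_one m)

/-- a subgroup containing some `K_m` is open. [folklore] -/
theorem isOpen_of_le {H : Subgroup G} {m : ℕ} (h : 𝒦.K m ≤ H) : @IsOpen G 𝒦.topology H := by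
  letI := 𝒦.topology
  haveI := 𝒦.isTopologicalGroup
  exact Subgroup.isOpen_mono h (𝒦.isOpen_K m)

end CongruenceBasis

/-! ## §2 The smooth-vector topology on `MpPsi ρ` -/

section Mp

variable {R : Type u} [CommRing R] [Invertible (2 : R)] {V : Type v} [AddCommGroup V] [Module R V]
  {B : V →ₗ[R] V →ₗ[R] R}
variable {k : Type u'} [Field k] {S : Type v'} [AddCommGroup S] [Module k S]
variable (𝒦 : CongruenceBasis (symplecticGroup B)) (ρ : Representation k (Heisenberg B) S)

/-- the basic subgroup `U_{m,A} = {(g, M) ∈ S̃p_ψ(W) | g ∈ K_m, M f = f (f ∈ A)}`. [cite: MoeglinVignerasWaldspurger1987, Chap. 2 II.8] -/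
def MpPsi.smoothNhd (m : ℕ) (A : Finset S) : Subgroup (MpPsi ρ) where
  carrier := {p | (p : symplecticGroup B × (S ≃ₗ[k] S)).1 ∈ 𝒦.K m ∧
    ∀ f ∈ A, (p : symplecticGroup B × (S ≃ₗ[k] S)).2 f = f}
  one_mem' := ⟨(𝒦.K m).one_mem, fun _ _ => rfl⟩
  mul_mem' := by
    rintro p q ⟨hp, hpA⟩ ⟨hq, hqA⟩
    refine ⟨(𝒦.K m).mul_mem hp hq, fun f hf => ?_⟩
    show ((p : symplecticGroup B × (S ≃ₗ[k] S)).2 * (q : symplecticGroup B × (S ≃ₗ[k] S)).2) f = f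
    rw [LinearEquiv.mul_apply, hqA f hf, hpA f hf]
  inv_mem' := by
    rintro p ⟨hp, hpA⟩
    refine ⟨(𝒦.K m).inv_mem hp, fun f hf => ?_⟩
    show ((p : symplecticGroup B × (S ≃ₗ[k] S)).2)⁻¹ f = f
    have h : (((p : symplecticGroup B × (S ≃ₗ[k] S)).2)⁻¹ * (p : symplecticGroup B × (S ≃ₗ[k] S)).2) f = f := by
      rw [inv_mul_cancel]; rfl
    rwa [LinearEquiv.mul_apply, hpA f hf] at h

/-- membership. [cite: MoeglinVignerasWaldspurger1987, Chap. 2 II.8] -/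
theorem MpPsi.mem_smoothNhd {m : ℕ} {A : Finset S} {p : MpPsi ρ} :
    p ∈ MpPsi.smoothNhd 𝒦 ρ m A ↔ (p : symplecticGroup B × (S ≃ₗ[k] S)).1 ∈ 𝒦.K m ∧
      ∀ f ∈ A, (p : symplecticGroup B × (S ≃ₗ[k] S)).2 f = f := Iff.rfl

/-- `U_{m,A}` decreases in `m` and `A`. [folklore] -/
theorem MpPsi.smoothNhd_mono {m m' : ℕ} (hm : m ≤ m') {A A' : Finset S} (hA : A ⊆ A') :
    MpPsi.smoothNhd 𝒦 ρ m' A' ≤ MpPsi.smoothNhd 𝒦 ρ m A :=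
  fun _ ⟨hp, hpA⟩ => ⟨𝒦.antitone hm hp, fun f hf => hpA f (hA hf)⟩

/-- **conjugation compatibility for free**: `(g, M) · U_{m', M⁻¹ A} · (g, M)⁻¹ ⊆ U_{m,A}` whenever
`g K_{m'} g⁻¹ ⊆ K_m`. [folklore] -/
theorem MpPsi.conj_smoothNhd_le [DecidableEq S] (p : MpPsi ρ) (m : ℕ) (A : Finset S) {m' : ℕ}
    (hm' : ∀ x ∈ 𝒦.K m', (p : symplecticGroup B × (S ≃ₗ[k] S)).1 * x *
      ((p : symplecticGroup B × (S ≃ₗ[k] S)).1)⁻¹ ∈ 𝒦.K m) :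
    ∀ q ∈ MpPsi.smoothNhd 𝒦 ρ m' (A.image fun f => ((p : symplecticGroup B × (S ≃ₗ[k] S)).2).symm f),
      p * q * p⁻¹ ∈ MpPsi.smoothNhd 𝒦 ρ m A := by
  rintro q ⟨hq, hqA⟩
  refine ⟨hm' _ hq, fun f hf => ?_⟩
  have hq' := hqA _ (Finset.mem_image_of_mem _ hf)
  show ((p : symplecticGroup B × (S ≃ₗ[k] S)).2 * (q : symplecticGroup B × (S ≃ₗ[k] S)).2 *
    ((p : symplecticGroup B × (S ≃ₗ[k] S)).2)⁻¹) f = f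
  rw [LinearEquiv.mul_apply, LinearEquiv.mul_apply]
  have e : ((p : symplecticGroup B × (S ≃ₗ[k] S)).2)⁻¹ f = ((p : symplecticGroup B × (S ≃ₗ[k] S)).2).symm f := rfl
  rw [e, hq', LinearEquiv.apply_symm_apply]

/-- the **smooth-vector group filter basis** `{U_{m,A}}` on `S̃p_ψ(W)`. [cite: MoeglinVignerasWaldspurger1987, Chap. 2 II.8] -/
@[implicit_reducible]
def MpPsi.filterBasis : GroupFilterBasis (MpPsi ρ) where
  sets := Set.range fun mA : ℕ × Finset S => (MpPsi.smoothNhd 𝒦 ρ mA.1 mA.2 : Set (MpPsi ρ))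
  nonempty := ⟨_, (0, ∅), rfl⟩
  inter_sets := by
    classical
    rintro _ _ ⟨⟨m, A⟩, rfl⟩ ⟨⟨m', A'⟩, rfl⟩
    exact ⟨_, ⟨(max m m', A ∪ A'), rfl⟩, Set.subset_inter
      (MpPsi.smoothNhd_mono 𝒦 ρ (le_max_left m m') Finset.subset_union_left)
      (MpPsi.smoothNhd_mono 𝒦 ρ (le_max_right m m') Finset.subset_union_right)⟩
  one' := by
    rintro _ ⟨mA, rfl⟩
    exact (MpPsi.smoothNhd 𝒦 ρ mA.1 mA.2).one_mem
  mul' := by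
    rintro _ ⟨mA, rfl⟩
    refine ⟨_, ⟨mA, rfl⟩, ?_⟩
    rintro _ ⟨a, ha, b, hb, rfl⟩
    exact (MpPsi.smoothNhd 𝒦 ρ mA.1 mA.2).mul_mem ha hb
  inv' := by
    rintro _ ⟨mA, rfl⟩
    exact ⟨_, ⟨mA, rfl⟩, fun x hx => (MpPsi.smoothNhd 𝒦 ρ mA.1 mA.2).inv_mem hx⟩
  conj' := by
    classical
    rintro p _ ⟨⟨m, A⟩, rfl⟩
    obtain ⟨m', hm'⟩ := 𝒦.conj (p : symplecticGroup B × (S ≃ₗ[k] S)).1 m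
    exact ⟨_, ⟨(m', A.image fun f => ((p : symplecticGroup B × (S ≃ₗ[k] S)).2).symm f), rfl⟩,
      fun q hq => MpPsi.conj_smoothNhd_le 𝒦 ρ p m A hm' q hq⟩

/-- `U_{m,A}` belongs to the filter basis. [folklore] -/
theorem MpPsi.mem_filterBasis (m : ℕ) (A : Finset S) :
    (MpPsi.smoothNhd 𝒦 ρ m A : Set (MpPsi ρ)) ∈ MpPsi.filterBasis 𝒦 ρ := ⟨(m, A), rfl⟩

/-- the **smooth-vector topology** on `S̃p_ψ(W)`. [cite: MoeglinVignerasWaldspurger1987, Chap. 2 II.8] -/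
@[implicit_reducible]
def MpPsi.topology : TopologicalSpace (MpPsi ρ) := (MpPsi.filterBasis 𝒦 ρ).topology

/-- it is a group topology. [folklore] -/
theorem MpPsi.isTopologicalGroup : @IsTopologicalGroup (MpPsi ρ) (MpPsi.topology 𝒦 ρ) _ :=
  (MpPsi.filterBasis 𝒦 ρ).isTopologicalGroup

/-- `U_{m,A}` is a neighbourhood of `1`. [folklore] -/
theorem MpPsi.smoothNhd_mem_nhds_one (m : ℕ) (A : Finset S) :
    (MpPsi.smoothNhd 𝒦 ρ m A : Set (MpPsi ρ)) ∈ @nhds (MpPsi ρ) (MpPsi.topology 𝒦 ρ) 1 :=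
  (MpPsi.filterBasis 𝒦 ρ).mem_nhds_one (MpPsi.mem_filterBasis 𝒦 ρ m A)

/-- the `U_{m,A}` form a basis of neighbourhoods of `1`. [folklore] -/
theorem MpPsi.nhds_one_hasBasis :
    (@nhds (MpPsi ρ) (MpPsi.topology 𝒦 ρ) 1).HasBasis (fun _ : ℕ × Finset S => True)
      fun mA => (MpPsi.smoothNhd 𝒦 ρ mA.1 mA.2 : Set (MpPsi ρ)) := by
  refine ((MpPsi.filterBasis 𝒦 ρ).nhds_one_hasBasis).to_hasBasis ?_ fun mA _ => ⟨_, ⟨mA, rfl⟩, le_rfl⟩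
  rintro _ ⟨mA, rfl⟩
  exact ⟨mA, trivial, le_rfl⟩

/-- `U_{m,A}` is open. [folklore] -/
theorem MpPsi.isOpen_smoothNhd (m : ℕ) (A : Finset S) :
    @IsOpen (MpPsi ρ) (MpPsi.topology 𝒦 ρ) (MpPsi.smoothNhd 𝒦 ρ m A) := by
  letI := MpPsi.topology 𝒦 ρ
  haveI := MpPsi.isTopologicalGroup 𝒦 ρ
  exact Subgroup.isOpen_of_mem_nhds _ (MpPsi.smoothNhd_mem_nhds_one 𝒦 ρ m A)

/-- **openness criterion**: a subgroup of `S̃p_ψ(W)` containing some `U_{m,A}` is open. [folklore] -/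
theorem MpPsi.isOpen_of_smoothNhd_le {H : Subgroup (MpPsi ρ)} {m : ℕ} {A : Finset S}
    (h : MpPsi.smoothNhd 𝒦 ρ m A ≤ H) : @IsOpen (MpPsi ρ) (MpPsi.topology 𝒦 ρ) H := by
  letI := MpPsi.topology 𝒦 ρ
  haveI := MpPsi.isTopologicalGroup 𝒦 ρ
  exact Subgroup.isOpen_mono h (MpPsi.isOpen_smoothNhd 𝒦 ρ m A)

/-- `U_{0,{f}}` lies in the stabiliser of `f`. [folklore] -/
theorem MpPsi.smoothNhd_le_stabilizerSubgroup (f : S) :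
    MpPsi.smoothNhd 𝒦 ρ 0 {f} ≤ (MpPsi.toRep ρ).stabilizerSubgroup f :=
  fun _ ⟨_, hpA⟩ => hpA f (Finset.mem_singleton_self f)

/-- **the Weil representation of `S̃p_ψ(W)` on `S` is smooth** (MVW II.8). [cite: MoeglinVignerasWaldspurger1987, Chap. 2 II.8] -/
theorem MpPsi.isSmooth_toRep : @Representation.IsSmooth k (MpPsi ρ) S _ _ _ _ (MpPsi.topology 𝒦 ρ) (MpPsi.toRep ρ) := by
  letI := MpPsi.topology 𝒦 ρ
  haveI := MpPsi.isTopologicalGroup 𝒦 ρ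
  exact fun f => Representation.isSmoothVector_of_le _ (MpPsi.isOpen_smoothNhd 𝒦 ρ 0 {f})
    (MpPsi.smoothNhd_le_stabilizerSubgroup 𝒦 ρ f)

/-- every vector is fixed by an open subgroup. [cite: MoeglinVignerasWaldspurger1987, Chap. 2 II.8] -/
theorem MpPsi.mem_fixedPoints_smoothNhd (f : S) : f ∈ (MpPsi.toRep ρ).fixedPoints (MpPsi.smoothNhd 𝒦 ρ 0 {f}) :=
  ((MpPsi.toRep ρ).mem_fixedPoints_iff_le_stabilizerSubgroup _ f).2
    (MpPsi.smoothNhd_le_stabilizerSubgroup 𝒦 ρ f)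

/-- **the projection `S̃p_ψ(W) → Sp(W)` is continuous** for the congruence topology on `Sp(W)`. [cite: MoeglinVignerasWaldspurger1987, Chap. 2 II.1 (B)] -/
theorem MpPsi.continuous_proj :
    @Continuous (MpPsi ρ) (symplecticGroup B) (MpPsi.topology 𝒦 ρ) 𝒦.topology (MpPsi.proj ρ) := by
  letI := MpPsi.topology 𝒦 ρ
  haveI := MpPsi.isTopologicalGroup 𝒦 ρ
  letI := 𝒦.topology
  haveI := 𝒦.isTopologicalGroup
  refine continuous_of_continuousAt_one (MpPsi.proj ρ) ?_
  rw [ContinuousAt, map_one, (MpPsi.nhds_one_hasBasis 𝒦 ρ).tendsto_iff 𝒦.nhds_one_hasBasis]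
  intro m _
  exact ⟨(m, ∅), trivial, fun p hp => hp.1⟩

/-- the scalars are discrete: `U_{m,A} ∩ kˣ = 1` as soon as `A ∋ f ≠ 0`. [folklore] -/
theorem MpPsi.ofScalar_mem_smoothNhd_iff {m : ℕ} {A : Finset S} {f : S} (hf : f ∈ A) (hf0 : f ≠ 0) (c : kˣ) :
    MpPsi.ofScalar ρ c ∈ MpPsi.smoothNhd 𝒦 ρ m A ↔ c = 1 := by
  constructor
  · rintro ⟨-, hA⟩
    have h := hA f hf
    rw [show ((MpPsi.ofScalar ρ c : MpPsi ρ) : symplecticGroup B × (S ≃ₗ[k] S)).2 f = (c : k) • f from rfl] at h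
    have h1 : (c : k) = 1 := smul_left_injective k hf0 (h.trans (one_smul k f).symm)
    exact Units.ext h1
  · rintro rfl
    rw [map_one]
    exact one_mem _

end Mp

end Literature.RepresentationTheory.HeisenbergGroup
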